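import Summits.AnomalousDissipation.AnomalousDissipation.Theorems.TaylorGreenLogLoudStates.Negative.MirrorClass

/-!
# Negative knowledge for the crux `TaylorGreenLogLoudStates` (stmt-AnomalousDissipation-15060, route MirrorVariety), V:
# the half-turn class of the picked line `Sketch` — `H`-symmetry inside Fix K is a half-period translation,
# and K-cells have impermeable caps

Certified copy of the `-- Line Sketch` section of the cdisprove work file `Cruxes/TaylorGreenLogLoudStates/Disproof.lean`
(refuter-cdisprove-stmt-AnomalousDissipation-15060-0, cycle 3 of the standing disprover = cycle 1 on the restored item).
Supports stmt-AnomalousDissipation-15060; no positive route-item statement is asserted.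

The picked line (`Cruxes/TaylorGreenLogLoudStates/Lines/Sketch.lean`, card `half-turn-parity-forcing`) witnesses the crux
inside the class "`K`-symmetric and NOT `H`-symmetric", `H x = (½ − x₀, x₁, ½ − x₂)` the half-turn of the Taylor–Green cell,
`IsHSymm u :↔ ∀ x, u (H x) = diag(−1,1,−1) · u x`; its milestone M1 is the existence of such steady Galerkin states and its
heart is a "through-flow Burgers column on the `C₄` axis carried by the `H`-broken branch". The definitions `halfTurnMat`,
`halfTurnShift`, `halfTurn`, `IsHSymm` below are VERBATIM the line's (which live in an unbuilt crux workfile and cannot be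
imported); results:

* `halfTurn_eq` — `H = R₀ ∘ R₂ ∘ (· + τ)` with `τ = (½, 0, ½)` (`= halfTurnShift`), and
  `actVec_halfTurnMat_eq` — `diag(−1,1,−1) = R₀R₂` on vectors.
* `isHSymm_iff_periodic` — **inside Fix K, `H`-symmetry is exactly invariance under the half-period face-diagonal
  translation `τ = (½,0,½)`** (a symmetry of `f_TG`). So "H-broken K-symmetric" means "K-symmetric and not
  `τ`-periodic", nothing about through-flow or handedness; `H`-broken states come in `τ`-translate pairs.
* `tgForce_add_halfTurnShift`, `isHSymm_tgForce` — `f_TG` is `τ`-periodic and `H`-symmetric (kernel-checked witness of the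
  line's symmetry claim).
* The impermeable-caps facts (`U_i = 0` on `x_i ∈ {0,½}` for K-fields: no THROUGH-flow column in a K-cell) are the companion
  file `Negative/Caps.lean`.
-/

noncomputable section

-- `Summit.<Summit>.<Problem>` is the tree's mandated summit-side namespace (CONVENTIONS §2); duplicate deliberate.
set_option linter.dupNamespace false

open scoped InnerProductSpace Topology
open MeasureTheory Filter
open Literature.Analysis.FunctionSpaces Literature.Analysis.FunctionSpaces.Torus
open Summit.AnomalousDissipation.AnomalousDissipation.Theorems.TaylorGreenLoudGalerkinStates.Negative
open Summit.AnomalousDissipation.AnomalousDissipation.Theorems.TaylorGreenLoudGalerkinStates (reflMat actVec IsKSymm)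
open Summit.AnomalousDissipation.AnomalousDissipation.Theorems.TaylorGreenLoudGalerkinStates.TgForceRegular
  (mulVecT_reflMat_apply actVec_reflMat_apply)

namespace Summit.AnomalousDissipation.AnomalousDissipation.Theorems.TaylorGreenLogLoudStates.Negative

/-! ### The half-turn of the Taylor–Green cell (verbatim the line's vocabulary) -/

/-- The linear part `diag(−1, 1, −1)` of the half-turn (verbatim `Lines/Sketch.lean`). -/
def halfTurnMat : Matrix (Fin 3) (Fin 3) ℤ :=
  Matrix.diagonal ![-1, 1, -1]

/-- The shift `τ = (½, 0, ½)` of the half-turn (verbatim `Lines/Sketch.lean`). -/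
def halfTurnShift : UnitAddTorus (Fin 3) :=
  fun i => if i = 1 then 0 else (((1 / 2 : ℝ)) : UnitAddCircle)

/-- The half-turn `H x = (½ − x₀, x₁, ½ − x₂)` (verbatim `Lines/Sketch.lean`). -/
def halfTurn (x : UnitAddTorus (Fin 3)) : UnitAddTorus (Fin 3) :=
  Torus.mulVecT halfTurnMat x + halfTurnShift

/-- `H`-symmetry of a vector field: `u (H x) = diag(−1,1,−1) · u x` (verbatim `Lines/Sketch.lean`). -/
def IsHSymm (u : UnitAddTorus (Fin 3) → EuclideanSpace ℝ (Fin 3)) : Prop :=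
  ∀ x, u (halfTurn x) = actVec halfTurnMat (u x)

/-- Coordinates of the linear part: `(diag(−1,1,−1) x)_l = x_l` if `l = 1`, else `−x_l`. [folklore] -/
theorem mulVecT_halfTurnMat_apply (x : UnitAddTorus (Fin 3)) (l : Fin 3) :
    Torus.mulVecT halfTurnMat x l = if l = 1 then x l else -x l := by
  rw [Torus.mulVecT_apply]
  fin_cases l <;> simp [halfTurnMat, Matrix.diagonal]

/-- Coordinates of the vector action: `(diag(−1,1,−1) v)_j = v_j` if `j = 1`, else `−v_j`. [folklore] -/
theorem actVec_halfTurnMat_apply (v : EuclideanSpace ℝ (Fin 3)) (j : Fin 3) :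
    actVec halfTurnMat v j = if j = 1 then v j else -v j := by
  fin_cases j <;>
    simp [actVec, halfTurnMat, Matrix.mulVec, dotProduct, Matrix.diagonal, Matrix.map_apply]

/-- `−½ = ½` on the unit circle (simp-normal form `2⁻¹`). [folklore] -/
theorem neg_half_eq_half : -((((2⁻¹ : ℝ)) : UnitAddCircle)) = (((2⁻¹ : ℝ)) : UnitAddCircle) := by
  rw [← AddCircle.coe_neg, ← AddCircle.coe_add_period 1 (-(2⁻¹) : ℝ)]
  norm_num

/-- `½ + ½ = 0` on the unit circle (simp-normal form `2⁻¹`). [folklore] -/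
theorem half_add_half_eq_zero : (((2⁻¹ : ℝ)) : UnitAddCircle) + (((2⁻¹ : ℝ)) : UnitAddCircle) = 0 := by
  rw [← AddCircle.coe_add, AddCircle.coe_eq_zero_iff]
  refine ⟨1, ?_⟩
  norm_num

/-- The shift is fixed by every coordinate reflection (`−½ = ½`, `−0 = 0`). [folklore] -/
theorem mulVecT_reflMat_halfTurnShift (i : Fin 3) : Torus.mulVecT (reflMat i) halfTurnShift = halfTurnShift := by
  funext l
  rw [mulVecT_reflMat_apply]
  split_ifs with h
  · fin_cases l <;> simp [halfTurnShift, neg_half_eq_half]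
  · rfl

/-- **`H = R₀ ∘ R₂ ∘ (· + τ)`**: the half-turn is the composite of two coordinate reflections with the half-period
translation `τ = (½, 0, ½)`. [folklore] -/
theorem halfTurn_eq (x : UnitAddTorus (Fin 3)) :
    halfTurn x = Torus.mulVecT (reflMat 0) (Torus.mulVecT (reflMat 2) (x + halfTurnShift)) := by
  funext l
  simp only [halfTurn, Pi.add_apply, mulVecT_halfTurnMat_apply, mulVecT_reflMat_apply]
  fin_cases l <;> simp [halfTurnShift, neg_half_eq_half] <;> abel

/-- **`diag(−1,1,−1) = R₀ R₂`** on velocity vectors. [folklore] -/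
theorem actVec_halfTurnMat_eq (v : EuclideanSpace ℝ (Fin 3)) :
    actVec halfTurnMat v = actVec (reflMat 0) (actVec (reflMat 2) v) := by
  ext j
  rw [actVec_halfTurnMat_apply, actVec_reflMat_apply, actVec_reflMat_apply]
  fin_cases j <;> simp

/-- `diag(−1,1,−1)` is an involution on vectors. [folklore] -/
theorem actVec_halfTurnMat_actVec (v : EuclideanSpace ℝ (Fin 3)) : actVec halfTurnMat (actVec halfTurnMat v) = v := by
  ext j
  rw [actVec_halfTurnMat_apply, actVec_halfTurnMat_apply]
  split_ifs <;> simp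

/-- For a K-symmetric field, `U (R₀ R₂ y) = diag(−1,1,−1) U y`. [folklore] -/
theorem apply_refl02_of_isKSymm {U : UnitAddTorus (Fin 3) → EuclideanSpace ℝ (Fin 3)} (hK : IsKSymm U)
    (y : UnitAddTorus (Fin 3)) :
    U (Torus.mulVecT (reflMat 0) (Torus.mulVecT (reflMat 2) y)) = actVec halfTurnMat (U y) := by
  rw [hK 0, hK 2, actVec_halfTurnMat_eq]

/-- **Inside Fix K, `H`-symmetry is `τ`-periodicity.** For a K-symmetric field `U`:
`IsHSymm U ↔ ∀ x, U (x + τ) = U x` with `τ = (½, 0, ½)` (`halfTurnShift`). Hence "H-broken K-symmetric" (the picked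
line's witness class, milestone M1 and heart) means exactly "K-symmetric and not invariant under the half-period
face-diagonal translation `τ`" — a statement about `τ`-periodicity, not about through-flow or handedness. [folklore] -/
theorem isHSymm_iff_periodic {U : UnitAddTorus (Fin 3) → EuclideanSpace ℝ (Fin 3)} (hK : IsKSymm U) :
    IsHSymm U ↔ ∀ x, U (x + halfTurnShift) = U x := by
  constructor
  · intro h x
    have h1 := h x
    rw [halfTurn_eq, apply_refl02_of_isKSymm hK] at h1
    have h2 := congrArg (actVec halfTurnMat) h1
    rwa [actVec_halfTurnMat_actVec, actVec_halfTurnMat_actVec] at h2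
  · intro h x
    rw [halfTurn_eq, apply_refl02_of_isKSymm hK, h x]

/-- **H-broken K-symmetric = not `τ`-periodic.** [folklore] -/
theorem not_isHSymm_iff_of_isKSymm {U : UnitAddTorus (Fin 3) → EuclideanSpace ℝ (Fin 3)} (hK : IsKSymm U) :
    ¬ IsHSymm U ↔ ∃ x, U (x + halfTurnShift) ≠ U x := by
  rw [isHSymm_iff_periodic hK]
  push Not
  rfl

/-- In Fourier terms `τ`-periodicity kills the modes with `k₀ + k₂` odd; pointwise it is tested on translates. The
`τ`-translate of a field. -/
def translateTau (U : UnitAddTorus (Fin 3) → EuclideanSpace ℝ (Fin 3)) : UnitAddTorus (Fin 3) → EuclideanSpace ℝ (Fin 3) :=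
  fun x => U (x + halfTurnShift)

/-- `τ + τ = 0`. [folklore] -/
theorem halfTurnShift_add_self : halfTurnShift + halfTurnShift = 0 := by
  funext l
  fin_cases l <;> simp [halfTurnShift, half_add_half_eq_zero]

/-- The `τ`-translate of a K-symmetric field is K-symmetric (`R_i τ = τ`). [folklore] -/
theorem isKSymm_translateTau {U : UnitAddTorus (Fin 3) → EuclideanSpace ℝ (Fin 3)} (hK : IsKSymm U) :
    IsKSymm (translateTau U) := by
  intro i x
  simp only [translateTau]
  rw [← hK i, map_add, mulVecT_reflMat_halfTurnShift]

/-- The `τ`-translate of an H-broken K-field is H-broken (H-broken states come in `τ`-pairs). [folklore] -/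
theorem not_isHSymm_translateTau {U : UnitAddTorus (Fin 3) → EuclideanSpace ℝ (Fin 3)} (hK : IsKSymm U)
    (hH : ¬ IsHSymm U) : ¬ IsHSymm (translateTau U) := by
  rw [not_isHSymm_iff_of_isKSymm (isKSymm_translateTau hK)]
  obtain ⟨x, hx⟩ := (not_isHSymm_iff_of_isKSymm hK).1 hH
  refine ⟨x, fun h => hx ?_⟩
  simp only [translateTau] at h
  rw [add_assoc, halfTurnShift_add_self, add_zero] at h
  exact h.symm

/-! ### `f_TG` is `τ`-periodic and `H`-symmetric -/

/-- `e₁(y + ½) = −e₁(y)`. [folklore] -/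
theorem fourier_one_add_half (y : UnitAddCircle) :
    fourier 1 (y + (((1 / 2 : ℝ)) : UnitAddCircle)) = -fourier 1 y := by
  have h := fourier_add_half_inv_index (one_ne_zero : (1 : ℤ) ≠ 0) (one_pos : (0 : ℝ) < 1) y
  simpa using h

/-- Coordinates of the `τ`-translate of a point. [folklore] -/
theorem add_halfTurnShift_coords (x : UnitAddTorus (Fin 3)) :
    (x + halfTurnShift) 0 = x 0 + (((1 / 2 : ℝ)) : UnitAddCircle) ∧ (x + halfTurnShift) 1 = x 1 ∧
      (x + halfTurnShift) 2 = x 2 + (((1 / 2 : ℝ)) : UnitAddCircle) := by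
  refine ⟨?_, ?_, ?_⟩ <;> simp [halfTurnShift]

open Summit.AnomalousDissipation.AnomalousDissipation.Theorems.TaylorGreenLoudGalerkinStates.TgForceRegular
  (tgForce_apply_coords euclid_ext3 isKSymm_tgForce) in
/-- **`f_TG` is `τ`-periodic** (`τ = (½,0,½)` flips the signs of `sin 2πx₀`/`cos 2πx₀` and `cos 2πx₂` together).
[folklore] -/
theorem tgForce_add_halfTurnShift (x : UnitAddTorus (Fin 3)) : tgForce (x + halfTurnShift) = tgForce x := by
  obtain ⟨a0, a1, a2⟩ := add_halfTurnShift_coords x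
  obtain ⟨t0, t1, t2⟩ := tgForce_apply_coords x
  obtain ⟨s0, s1, s2⟩ := tgForce_apply_coords (x + halfTurnShift)
  refine euclid_ext3 ?_ ?_ ?_
  · rw [s0, t0, a0, a1, a2, fourier_one_add_half, fourier_one_add_half, Complex.neg_im, Complex.neg_re]; ring
  · rw [s1, t1, a0, a1, a2, fourier_one_add_half, fourier_one_add_half, Complex.neg_re, Complex.neg_re]; ring
  · rw [s2, t2]

open Summit.AnomalousDissipation.AnomalousDissipation.Theorems.TaylorGreenLoudGalerkinStates.TgForceRegular
  (isKSymm_tgForce) in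
/-- **`f_TG` is `H`-symmetric** (the half-turn is a symmetry of the Taylor–Green force, as the line asserts; a
kernel-checked witness of `IsHSymm`). [folklore] -/
theorem isHSymm_tgForce : IsHSymm tgForce :=
  (isHSymm_iff_periodic isKSymm_tgForce).2 tgForce_add_halfTurnShift

end Summit.AnomalousDissipation.AnomalousDissipation.Theorems.TaylorGreenLogLoudStates.Negative

end
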